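import Summits.MatrixMultiplication.OmegaCensus.STPPSmallPatternWitnesses

/-!
# ω-census, `(1,2,2)²¹` host law: seed types off the product route, part C (kit find)

**`ℤ/125 × ℤ/5` (625), the largest k = 21 seed type of the `564` plan left open by parts A/B and the split route, hosts `(1,2,2)²¹`** — decide witness from the night-34
reserve R9 'stpp3-k21-residual' (kit j338059, `find122.py`, fired and harvested by lead g44; ENG1 g38's Def-5.1 literal leg PASS; literal re-check also in the generator).
k = 21 open list after this file: `(ℤ/11)² × ℤ/5` (605), `(ℤ/17)² × ℤ/2` (578), `(ℤ/9)² × ℤ/7` (567) (R9 blank on them at 600 s; no word) ⇒ desk threshold 606; the window law over `[564, 648]`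
carries X = these three.

HONEST FRAMING (pub-omega census; verbatim): lottery ticket; floor = certified bounds/negative ranges.
Census STRUCTURE bookkeeping of the STPP track (seat pub-omega-stpp-3, gen 30; STRUCTURE row B5, columns `T1`/`T2`, §2 C10 row 21), not progress on `ω`:
small patterns in small groups bound no exponent.

References: H. Cohn, R. Kleinberg, B. Szegedy, C. Umans, FOCS 2005 (arXiv:math/0511460), Def. 5.1.  Records: HOME `pub-omega-stpp-3-g30/work/t2k21/` (generator `code/k30/mk_residual13.py`, gen 27/28/29/30).
-/

open Literature.Computability.AlgebraicComplexity Finset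

namespace Summit.MatrixMultiplication.OmegaCensus

set_option maxHeartbeats 0 in
/-- **`(1,2,2)²¹ ⊆ ℤ/125 × ℤ/5`** (order `625`; night-34 reserve R9 'stpp3-k21-residual' (kit j338059, fired by lead g44; ENG1 Def-5.1 literal PASS) find, engine `t2dfsw/find122`, literal Def-5.1 re-check). [cite: CohnKleinbergSzegedyUmans2005, Def. 5.1] -/
theorem exists_isSTPP_122pow21_seed_125_5 :
    ∃ A B C : Fin 21 → Finset (ZMod 125 × ZMod 5), IsSTPP A B C ∧ ∀ i, (A i).card = 1 ∧ (B i).card = 2 ∧ (C i).card = 2 :=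
  exists_isSTPP_of_lists_cards (H := ZMod 125 × ZMod 5)
    ![[(0, 0)], [(0, 0)], [(0, 0)], [(0, 0)], [(0, 0)], [(0, 0)], [(0, 0)], [(0, 0)], [(0, 0)], [(0, 0)], [(0, 0)], [(0, 0)], [(0, 0)], [(0, 0)], [(0, 0)], [(0, 0)], [(0, 0)], [(0, 0)], [(0, 0)], [(0, 0)], [(0, 0)]]
    ![[(0, 0), (0, 1)], [(1, 0), (1, 1)], [(3, 0), (3, 1)], [(4, 0), (4, 1)], [(9, 0), (9, 1)], [(10, 0), (10, 1)], [(12, 0), (12, 1)], [(13, 0), (13, 1)], [(27, 0), (27, 1)], [(28, 0), (28, 1)], [(30, 0), (30, 1)], [(31, 0), (31, 1)], [(36, 0), (36, 1)], [(37, 0), (37, 1)], [(39, 0), (39, 1)], [(40, 0), (40, 1)], [(81, 0), (82, 0)], [(82, 1), (83, 1)], [(82, 2), (83, 2)], [(82, 3), (83, 3)], [(82, 4), (83, 4)]]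
    ![[(0, 0), (0, 2)], [(2, 0), (2, 2)], [(6, 0), (6, 2)], [(8, 0), (8, 2)], [(18, 0), (18, 2)], [(20, 0), (20, 2)], [(24, 0), (24, 2)], [(26, 0), (26, 2)], [(54, 0), (54, 2)], [(56, 0), (56, 2)], [(60, 0), (60, 2)], [(62, 0), (62, 2)], [(72, 0), (72, 2)], [(74, 0), (74, 2)], [(78, 0), (78, 2)], [(80, 0), (80, 2)], [(81, 3), (89, 3)], [(88, 4), (97, 4)], [(99, 0), (101, 0)], [(103, 1), (105, 1)], [(107, 2), (115, 2)]]
    (by decide +kernel) (by decide +kernel)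

end Summit.MatrixMultiplication.OmegaCensus
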